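import Literature.Geometry.Kaehler.RealStructure
import Literature.Geometry.Kaehler.Kaehler
import Literature.Analysis.Complex.OsgoodProofs
import Mathlib.Geometry.Manifold.ContMDiff.Atlas
import Mathlib.Geometry.Manifold.ContMDiff.NormedSpace
import Mathlib.Geometry.Manifold.MFDeriv.Atlas
import HarnessLib

/-!
# Anti-holomorphic maps are real-analytic (companion to `RealStructure.lean`)

Topic `Literature/Geometry/Kaehler`; namespace `Literature.Geometry.Kaehler`. The file
`RealStructure.lean` defines anti-holomorphic maps between complex manifolds in Silhol's
sheaf-theoretic form (`IsAntiholomorphic I I' σ`: `σ` continuous and `conj ∘ f ∘ σ` holomorphic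
on `σ ⁻¹' U` whenever `f` is holomorphic on the open set `U`) and announces that "for complex
manifolds with finite-dimensional model it is equivalent to 'in charts, `σ` followed by
coordinatewise conjugation is holomorphic', and it implies that `σ` is real-analytic for the
underlying real manifolds (companion file `RealStructureSmooth`)". This is that companion file:

* `IsAntiholomorphic.differentiableOn_conj_comp_charts` — in any charts `e`, `e'` of the
  holomorphic (`C^ω` over `ℂ`) maximal atlases, every coordinate `conj ∘ ℓ ∘ e' ∘ σ ∘ e⁻¹`
  (`ℓ` a complex-linear functional on the model) is complex differentiable on the open set
  `e (e.source ∩ σ ⁻¹' e'.source)` (take `f = ℓ ∘ e'`, `U = e'.source` in Silhol's definition and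
  read `MDifferentiableOn` in the charts `e`, `id_ℂ`);
* `IsAntiholomorphic.contDiffOn_charts` — hence (Osgood's lemma, tree file
  `Literature/Analysis/Complex/OsgoodProofs.lean`, finite-dimensional models) the chart
  expression `e' ∘ σ ∘ e⁻¹` is real-analytic, `ContDiffOn ℝ ω`, on that open set (each
  `conj ∘ (coordinate)` is complex-analytic, so each coordinate is real-analytic);
* `IsAntiholomorphic.contMDiff` — `σ` is `C^∞` (indeed `C^n` for every `n ≤ ∞`) as a map of the
  underlying real manifolds (`IsManifold 𝓘(ℝ, E) ∞ M` from
  `Literature.Geometry.Kaehler.isManifold_real_of_isManifold_complex`);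
* `IsAntiholomorphic.fderiv_charts_I_smul` — the real derivative of a chart expression of `σ`
  is conjugate-linear: `D(e' ∘ σ ∘ e⁻¹)(v)(i w) = -i D(e' ∘ σ ∘ e⁻¹)(v)(w)`.

Silhol, *Real Algebraic Surfaces*, LNM 1392 (1989), Ch. I §1, (1.1)–(1.2) and p. 2 (the conjugate
manifold has the atlas `(Uᵢ, jₙ ∘ φᵢ)`; a morphism to it is anti-holomorphic in charts); the
regularity statement is folklore (holomorphic in the conjugate charts ⇒ real-analytic).

## References

* [Silhol1989] R. Silhol, *Real Algebraic Surfaces*, LNM 1392, Springer (1989), Ch. I §1.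
* [HormanderSCV1973] L. Hörmander, *An Introduction to Complex Analysis in Several Variables*
  (1973), Thm. 2.2.1, 2.2.6 (Osgood), via `Literature.Analysis.Complex.SCV`.
-/

noncomputable section

open Set Function
open scoped Manifold Topology ComplexConjugate ContDiff

namespace Literature.Geometry.Kaehler

variable {E : Type*} [NormedAddCommGroup E] [NormedSpace ℂ E]
  {F : Type*} [NormedAddCommGroup F] [NormedSpace ℂ F]
  {M : Type*} [TopologicalSpace M] [ChartedSpace E M]
  {N : Type*} [TopologicalSpace N] [ChartedSpace F N]

namespace IsAntiholomorphic

omit [NormedSpace ℂ E] [NormedSpace ℂ F] [ChartedSpace E M] [ChartedSpace F N] in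
/-- The set on which the chart expression `e' ∘ σ ∘ e⁻¹` of a continuous map is naturally
defined, `e (e.source ∩ σ ⁻¹' e'.source)`, is open. [folklore] -/
theorem isOpen_image_source_inter_preimage {σ : M → N} (hσ : Continuous σ)
    (e : OpenPartialHomeomorph M E) (e' : OpenPartialHomeomorph N F) :
    IsOpen (e '' (e.source ∩ σ ⁻¹' e'.source)) :=
  e.isOpen_image_of_subset_source (e.open_source.inter (e'.open_source.preimage hσ))
    inter_subset_left

/-- **Anti-holomorphic maps are anti-holomorphic in charts** (Silhol (1989), Ch. I §1, p. 2: a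
morphism `(M, 𝒪_M) → (N, 𝒪̄_N)` to the conjugate manifold, whose atlas is `(Uᵢ, jₙ ∘ φᵢ)`): for
charts `e`, `e'` of the holomorphic maximal atlases and a complex-linear functional `ℓ` on the
model of `N`, the function `conj ∘ ℓ ∘ e' ∘ σ ∘ e⁻¹` is complex differentiable on
`e (e.source ∩ σ ⁻¹' e'.source)`. [cite: Silhol1989, Ch. I §1, (1.1)–(1.2)] -/
theorem differentiableOn_conj_comp_charts [IsManifold 𝓘(ℂ, E) ω M] [IsManifold 𝓘(ℂ, F) ω N]
    {σ : M → N} (hσ : IsAntiholomorphic 𝓘(ℂ, E) 𝓘(ℂ, F) σ)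
    {e : OpenPartialHomeomorph M E} (he : e ∈ IsManifold.maximalAtlas 𝓘(ℂ, E) ω M)
    {e' : OpenPartialHomeomorph N F} (he' : e' ∈ IsManifold.maximalAtlas 𝓘(ℂ, F) ω N)
    (ℓ : F →L[ℂ] ℂ) :
    DifferentiableOn ℂ (fun v ↦ conj (ℓ (e' (σ (e.symm v)))))
      (e '' (e.source ∩ σ ⁻¹' e'.source)) := by
  -- the local holomorphic function `f = ℓ ∘ e'` on `U = e'.source`
  set f : N → ℂ := fun y ↦ ℓ (e' y) with hf_def
  have hf : MDifferentiableOn 𝓘(ℂ, F) 𝓘(ℂ, ℂ) f e'.source := by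
    have h1 : ContMDiffOn 𝓘(ℂ, F) 𝓘(ℂ, F) ω e' e'.source := contMDiffOn_of_mem_maximalAtlas he'
    have h2 : ContMDiff 𝓘(ℂ, F) 𝓘(ℂ, ℂ) ω (ℓ : F → ℂ) := ℓ.contMDiff
    exact (h2.comp_contMDiffOn h1).mdifferentiableOn (by simp)
  -- Silhol's axiom: `conj ∘ f ∘ σ` is holomorphic on `σ ⁻¹' U`
  have h := hσ.mdifferentiableOn_conj_comp e'.open_source hf
  set s : Set M := e.source ∩ σ ⁻¹' e'.source with hs_def
  have hs : MDifferentiableOn 𝓘(ℂ, E) 𝓘(ℂ, ℂ) (fun x ↦ conj (f (σ x))) s :=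
    h.mono inter_subset_right
  have he1 : e ∈ IsManifold.maximalAtlas 𝓘(ℂ, E) 1 M :=
    IsManifold.maximalAtlas_subset_of_le le_top he
  have hc1 : chartAt ℂ (0 : ℂ) ∈ IsManifold.maximalAtlas 𝓘(ℂ, ℂ) 1 ℂ :=
    IsManifold.chart_mem_maximalAtlas _
  have key := (mdifferentiableOn_iff_of_mem_maximalAtlas' (I := 𝓘(ℂ, E)) (I' := 𝓘(ℂ, ℂ))
    (f := fun x ↦ conj (f (σ x))) he1 hc1 inter_subset_left (fun _ _ ↦ by simp)).1 hs
  have himg : (e.extend 𝓘(ℂ, E)) '' s = e '' s := by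
    simp
  rw [himg] at key
  refine key.congr fun v hv ↦ ?_
  simp [hf_def]

/-- **The chart expressions of an anti-holomorphic map are real-analytic.** For complex
manifolds with finite-dimensional models and charts `e`, `e'` of the holomorphic maximal atlases,
`e' ∘ σ ∘ e⁻¹` is `ContDiffOn ℝ ω` on `e (e.source ∩ σ ⁻¹' e'.source)`: by
`differentiableOn_conj_comp_charts` and Osgood's lemma every function `conj ∘ ℓ ∘ (e' ∘ σ ∘ e⁻¹)`
is complex-analytic, hence real-analytic, hence so is every coordinate `ℓ ∘ (e' ∘ σ ∘ e⁻¹)`.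
[folklore] -/
theorem contDiffOn_charts [FiniteDimensional ℂ E] [FiniteDimensional ℂ F]
    [IsManifold 𝓘(ℂ, E) ω M] [IsManifold 𝓘(ℂ, F) ω N]
    {σ : M → N} (hσ : IsAntiholomorphic 𝓘(ℂ, E) 𝓘(ℂ, F) σ)
    {e : OpenPartialHomeomorph M E} (he : e ∈ IsManifold.maximalAtlas 𝓘(ℂ, E) ω M)
    {e' : OpenPartialHomeomorph N F} (he' : e' ∈ IsManifold.maximalAtlas 𝓘(ℂ, F) ω N) :
    ContDiffOn ℝ ω (fun v ↦ e' (σ (e.symm v))) (e '' (e.source ∩ σ ⁻¹' e'.source)) := by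
  set O := e '' (e.source ∩ σ ⁻¹' e'.source) with hO_def
  have hO : IsOpen O := isOpen_image_source_inter_preimage hσ.continuous e e'
  set G : E → F := fun v ↦ e' (σ (e.symm v)) with hG_def
  -- every coordinate of `G` is real-analytic
  have hℓ : ∀ ℓ : F →L[ℂ] ℂ, ContDiffOn ℝ ω (fun v ↦ ℓ (G v)) O := by
    intro ℓ
    have hd := hσ.differentiableOn_conj_comp_charts he he' ℓ
    have han : AnalyticOnNhd ℂ (fun v ↦ conj (ℓ (e' (σ (e.symm v))))) O :=
      Literature.Analysis.Complex.SCV.analyticOnNhd_of_differentiableOn hd hO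
    have hr : ContDiffOn ℝ ω (fun v ↦ conj (ℓ (G v))) O :=
      (han.contDiffOn_of_completeSpace (n := ω)).restrict_scalars ℝ
    have h2 := Complex.conjCLE.contDiff.comp_contDiffOn hr
    refine h2.congr fun v _ ↦ ?_
    simp [hG_def]
  -- assemble the coordinates through a basis of `F`
  set b := Module.finBasis ℂ F with hb_def
  set L : F ≃L[ℂ] (Fin (Module.finrank ℂ F) → ℂ) := b.equivFun.toContinuousLinearEquiv
    with hL_def
  have hL : ContDiffOn ℝ ω (fun v ↦ L (G v)) O := by
    rw [contDiffOn_pi]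
    intro k
    exact hℓ ((ContinuousLinearMap.proj k).comp (L : F →L[ℂ] Fin (Module.finrank ℂ F) → ℂ))
  have h3 := (L.symm.contDiff.restrict_scalars ℝ).comp_contDiffOn hL
  refine h3.congr fun v _ ↦ ?_
  simp

/-- **An anti-holomorphic map is `C^n` for the underlying real manifolds** (`n ≤ ∞`; complex
manifolds with finite-dimensional models, real structure groupoid from
`isManifold_real_of_isManifold_complex`). Silhol (1989), Ch. I §1: anti-holomorphic = holomorphic
into the conjugate manifold, in particular real-analytic. [folklore] -/
theorem contMDiff [FiniteDimensional ℂ E] [FiniteDimensional ℂ F]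
    [IsManifold 𝓘(ℂ, E) ω M] [IsManifold 𝓘(ℂ, F) ω N]
    {σ : M → N} (hσ : IsAntiholomorphic 𝓘(ℂ, E) 𝓘(ℂ, F) σ) {n : ℕ∞} :
    ContMDiff 𝓘(ℝ, E) 𝓘(ℝ, F) n σ := by
  haveI : IsManifold 𝓘(ℝ, E) ∞ M := isManifold_real_of_isManifold_complex
  haveI : IsManifold 𝓘(ℝ, F) ∞ N := isManifold_real_of_isManifold_complex
  suffices h : ContMDiff 𝓘(ℝ, E) 𝓘(ℝ, F) ∞ σ from h.of_le (by exact_mod_cast le_top)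
  rw [contMDiff_iff]
  refine ⟨hσ.continuous, fun x y ↦ ?_⟩
  have hx : chartAt E x ∈ IsManifold.maximalAtlas 𝓘(ℂ, E) ω M := IsManifold.chart_mem_maximalAtlas x
  have hy : chartAt F y ∈ IsManifold.maximalAtlas 𝓘(ℂ, F) ω N := IsManifold.chart_mem_maximalAtlas y
  have h : ContDiffOn ℝ ∞ _ _ := (hσ.contDiffOn_charts hx hy).of_le le_top
  have hset : (extChartAt 𝓘(ℝ, E) x).target ∩
      (extChartAt 𝓘(ℝ, E) x).symm ⁻¹' (σ ⁻¹' (extChartAt 𝓘(ℝ, F) y).source) =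
      chartAt E x '' ((chartAt E x).source ∩ σ ⁻¹' (chartAt F y).source) := by
    rw [OpenPartialHomeomorph.image_source_inter_eq']
    simp
  rw [hset]
  refine h.congr fun v _ ↦ ?_
  simp

/-- **The real derivative of a chart expression of an anti-holomorphic map is
conjugate-linear**: at a point of `e (e.source ∩ σ ⁻¹' e'.source)`,
`D(e' ∘ σ ∘ e⁻¹)(v)(i • w) = -(i • D(e' ∘ σ ∘ e⁻¹)(v)(w))` (every `conj ∘ ℓ ∘ (e' ∘ σ ∘ e⁻¹)`
has a complex-linear derivative). Silhol (1989), Ch. I §1, p. 1 (`f^σ = j ∘ f ∘ jₙ`).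
[folklore] -/
theorem fderiv_charts_I_smul [FiniteDimensional ℂ E] [FiniteDimensional ℂ F]
    [IsManifold 𝓘(ℂ, E) ω M] [IsManifold 𝓘(ℂ, F) ω N]
    {σ : M → N} (hσ : IsAntiholomorphic 𝓘(ℂ, E) 𝓘(ℂ, F) σ)
    {e : OpenPartialHomeomorph M E} (he : e ∈ IsManifold.maximalAtlas 𝓘(ℂ, E) ω M)
    {e' : OpenPartialHomeomorph N F} (he' : e' ∈ IsManifold.maximalAtlas 𝓘(ℂ, F) ω N)
    {v : E} (hv : v ∈ e '' (e.source ∩ σ ⁻¹' e'.source)) (w : E) :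
    fderiv ℝ (fun v ↦ e' (σ (e.symm v))) v (Complex.I • w) =
      -(Complex.I • fderiv ℝ (fun v ↦ e' (σ (e.symm v))) v w) := by
  set O := e '' (e.source ∩ σ ⁻¹' e'.source) with hO_def
  have hO : IsOpen O := isOpen_image_source_inter_preimage hσ.continuous e e'
  set G : E → F := fun v ↦ e' (σ (e.symm v)) with hG_def
  have hG : DifferentiableAt ℝ G v :=
    ((hσ.contDiffOn_charts he he').differentiableOn (by simp)).differentiableAt (hO.mem_nhds hv)
  -- test against every complex-linear functional
  suffices key : ∀ ℓ : F →L[ℂ] ℂ, ℓ (fderiv ℝ G v (Complex.I • w)) =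
      ℓ (-(Complex.I • fderiv ℝ G v w)) by
    set b := Module.finBasis ℂ F
    refine b.ext_elem fun k ↦ ?_
    have := key ((b.coord k).toContinuousLinearMap)
    simpa using this
  intro ℓ
  -- `conj ∘ ℓ ∘ G` is complex differentiable at `v`
  have hd : DifferentiableAt ℂ (fun v ↦ conj (ℓ (G v))) v :=
    (hσ.differentiableOn_conj_comp_charts he he' ℓ).differentiableAt (hO.mem_nhds hv)
  -- its real derivative, computed by the chain rule
  have hchain : HasFDerivAt (fun v ↦ conj (ℓ (G v)))
      ((Complex.conjCLE : ℂ →L[ℝ] ℂ).comp ((ℓ.restrictScalars ℝ).comp (fderiv ℝ G v))) v := by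
    have h1 : HasFDerivAt G (fderiv ℝ G v) v := hG.hasFDerivAt
    have h2 : HasFDerivAt (fun v ↦ ℓ (G v)) ((ℓ.restrictScalars ℝ).comp (fderiv ℝ G v)) v :=
      (ℓ.restrictScalars ℝ).hasFDerivAt.comp v h1
    exact Complex.conjCLE.hasFDerivAt.comp v h2
  have hR : fderiv ℝ (fun v ↦ conj (ℓ (G v))) v =
      (Complex.conjCLE : ℂ →L[ℝ] ℂ).comp ((ℓ.restrictScalars ℝ).comp (fderiv ℝ G v)) :=
    hchain.fderiv
  -- and it is the restriction of scalars of the complex derivative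
  have hC : fderiv ℝ (fun v ↦ conj (ℓ (G v))) v =
      (fderiv ℂ (fun v ↦ conj (ℓ (G v))) v).restrictScalars ℝ :=
    (hd.hasFDerivAt.restrictScalars ℝ).fderiv
  have hlin : ∀ u : E, conj (ℓ (fderiv ℝ G v (Complex.I • u))) =
      Complex.I * conj (ℓ (fderiv ℝ G v u)) := by
    intro u
    have e1 : (fderiv ℝ (fun v ↦ conj (ℓ (G v))) v) (Complex.I • u) =
        conj (ℓ (fderiv ℝ G v (Complex.I • u))) := by rw [hR]; rfl
    have e2 : (fderiv ℝ (fun v ↦ conj (ℓ (G v))) v) u = conj (ℓ (fderiv ℝ G v u)) := by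
      rw [hR]; rfl
    rw [← e1, ← e2, hC]
    simp [ContinuousLinearMap.coe_restrictScalars', map_smul, smul_eq_mul]
  have h := hlin w
  -- unconjugate
  have h' : ℓ (fderiv ℝ G v (Complex.I • w)) = conj (Complex.I * conj (ℓ (fderiv ℝ G v w))) := by
    rw [← h, Complex.conj_conj]
  rw [h', map_neg, map_smul]
  simp [map_mul, Complex.conj_I, smul_eq_mul]

end IsAntiholomorphic

/-- A real structure on a complex manifold with finite-dimensional model is a `C^∞` map of the
underlying real manifold. [folklore] -/
theorem RealStructure.contMDiff [FiniteDimensional ℂ E] [IsManifold 𝓘(ℂ, E) ω M]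
    (σ : RealStructure 𝓘(ℂ, E) M) {n : ℕ∞} : ContMDiff 𝓘(ℝ, E) 𝓘(ℝ, E) n σ :=
  σ.isAntiholomorphic.contMDiff

end Literature.Geometry.Kaehler

end
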